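import Summits.CriticalPhenomena.Ising3DConformalLimit.Theorems.EnergyNotSigmaSquaredMoebiusLimitExistsDefs
import Literature.Probability.LatticeModels.HighDimPointwiseTriviality
import Literature.Probability.LatticeModels.CriticalTwoPointBounds
import Mathlib.Analysis.Normed.Group.Bounded
import Mathlib.Analysis.SpecialFunctions.Pow.Continuity
import HarnessLib

/-!
# The pinned two-point function under the two-point law
(line `only-interaction-breaks-moebius` of the crux `MoebiusLimitExists`, item stmt-CriticalPhenomena-1344;
stub `stub_pinnedTwoPoint`)

With the PINNED renormalisation `ρ_pin(δ) = ⟨σ₀σ_{⌊1/δ⌋e₀}⟩_{β_c}^{-1/2}` (`rhoPin`) the rescaled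
critical two-point correlator at mesh `δ` is the RATIO
`ρ_pin(δ)² ⟨σ_{[x₀/δ]}σ_{[x₁/δ]}⟩_{β_c} = ⟨σ₀σ_{z_δ}⟩_{β_c} / ⟨σ₀σ_{⌊1/δ⌋e₀}⟩_{β_c}`,
`z_δ = [x₁/δ] − [x₀/δ]`. Under the two-point law `⟨σ₀σ_y⟩_{β_c}‖y‖₂^{2Δ} → c > 0` (`y → ∞`,
item stmt-0634, passed as data) both lattice points leave every finite set along a mesh sequence
`u k → 0⁺`, `u k‖z_{u k}‖₂ → ‖x₁ − x₀‖` and `u k ⌊1/u k⌋ → 1`, so the ratio tends to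
`‖x₁ − x₀‖^{-2Δ}`; by uniqueness of limits this is the value `S 2 x` of every cluster point `S` of the
pinned zoom (`IsClusterPoint`). This is `stub_pinnedTwoPoint` of the checked skeleton.

Contents: floor asymptotics of lattice approximations along a mesh sequence
(`tendsto_mul_latticeApprox_sub_apply`), escape to infinity in `ℤ³` (`tendsto_cofinite_of_mul_apply`),
the Euclidean norm along the sequence (`tendsto_mul_sqrt_sum_sq`), the resulting asymptotics of
`⟨σ₀σ_{v_k}⟩ u_k^{-2Δ}` (`tendsto_criticalTwoPoint_mul_rpow`), `ρ_pin² = ⟨σ₀σ_{⌊1/δ⌋e₀}⟩⁻¹`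
(`rhoPin_sq`), and the stub.
-/

noncomputable section

open Filter Topology Set Function
open Literature.Probability.LatticeModels

namespace Summit.CriticalPhenomena.Ising3DConformalLimit.MoebiusLimitExistsOnlyInteraction

/-! ### Floor asymptotics along a mesh sequence -/

/-- Along a mesh sequence `u k → 0⁺`, `u k · ([q/u k] − [p/u k])ᵢ → qᵢ − pᵢ` coordinatewise
(`|δ([q/δ]ᵢ − [p/δ]ᵢ) − (qᵢ − pᵢ)| ≤ 2δ`). [folklore] -/
theorem tendsto_mul_latticeApprox_sub_apply {u : ℕ → ℝ} (hu : Tendsto u atTop (𝓝[>] (0 : ℝ)))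
    (p q : EuclideanSpace ℝ (Fin 3)) (i : Fin 3) :
    Tendsto (fun k => u k * ((latticeApprox (u k) q - latticeApprox (u k) p) i : ℝ)) atTop
      (𝓝 ((q - p) i)) := by
  have hu0 : Tendsto u atTop (𝓝 0) := (tendsto_nhdsWithin_iff.1 hu).1
  have hupos : ∀ᶠ k in atTop, 0 < u k := (tendsto_nhdsWithin_iff.1 hu).2
  rw [tendsto_iff_norm_sub_tendsto_zero]
  have h2 : Tendsto (fun k => 2 * u k) atTop (𝓝 0) := by
    simpa using hu0.const_mul (2 : ℝ)
  refine squeeze_zero' (Eventually.of_forall fun k => norm_nonneg _) ?_ h2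
  filter_upwards [hupos] with k hk
  rw [Real.norm_eq_abs, Pi.sub_apply, Int.cast_sub, PiLp.sub_apply]
  exact abs_mul_sub_latticeApprox_sub_le hk q p i

/-- If `u k · (v k)ᵢ → t ≠ 0` for some coordinate `i` along a mesh sequence `u k → 0⁺`, then the
lattice points `v k ∈ ℤ³` leave every finite set. [folklore] -/
theorem tendsto_cofinite_of_mul_apply {u : ℕ → ℝ} {v : ℕ → Site 3} {i : Fin 3} {t : ℝ}
    (hu : Tendsto u atTop (𝓝[>] (0 : ℝ))) (ht : t ≠ 0)
    (h : Tendsto (fun k => u k * (v k i : ℝ)) atTop (𝓝 t)) :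
    Tendsto v atTop cofinite := by
  have hupos : ∀ᶠ k in atTop, 0 < u k := (tendsto_nhdsWithin_iff.1 hu).2
  have hinv : Tendsto (fun k => (u k)⁻¹) atTop atTop := tendsto_inv_nhdsGT_zero.comp hu
  have habs : Tendsto (fun k => |u k * (v k i : ℝ)| * (u k)⁻¹) atTop atTop :=
    h.abs.pos_mul_atTop (abs_pos.2 ht) hinv
  have hnorm : Tendsto (fun k => ‖v k‖) atTop atTop := by
    refine tendsto_atTop_mono' _ ?_ habs
    filter_upwards [hupos] with k hk
    rw [abs_mul, abs_of_pos hk, mul_comm, ← mul_assoc, inv_mul_cancel₀ hk.ne', one_mul]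
    have hle := norm_le_pi_norm (v k) i
    rwa [Int.norm_eq_abs] at hle
  rw [← cocompact_eq_cofinite (Site 3), ← Metric.cobounded_eq_cocompact]
  exact tendsto_norm_atTop_iff_cobounded.1 hnorm

/-- If `u k · (v k)ᵢ → rᵢ` for every coordinate and `u k > 0` eventually, then
`u k · ‖v k‖₂ → ‖r‖₂`. [folklore] -/
theorem tendsto_mul_sqrt_sum_sq {u : ℕ → ℝ} {v : ℕ → Site 3} {r : EuclideanSpace ℝ (Fin 3)}
    (hupos : ∀ᶠ k in atTop, 0 < u k)
    (h : ∀ i, Tendsto (fun k => u k * (v k i : ℝ)) atTop (𝓝 (r i))) :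
    Tendsto (fun k => u k * Real.sqrt (∑ i, ((v k i : ℝ)) ^ 2)) atTop (𝓝 ‖r‖) := by
  have h1 : Tendsto (fun k => Real.sqrt (∑ i, (u k * (v k i : ℝ)) ^ 2)) atTop (𝓝 ‖r‖) := by
    have hr : ‖r‖ = Real.sqrt (∑ i, (r i) ^ 2) := by
      rw [EuclideanSpace.norm_eq]
      congr 1
      exact Finset.sum_congr rfl fun i _ => by rw [Real.norm_eq_abs, sq_abs]
    rw [hr]
    exact (tendsto_finsetSum _ fun i _ => (h i).pow 2).sqrt
  refine h1.congr' ?_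
  filter_upwards [hupos] with k hk
  have hsum : (∑ i, (u k * (v k i : ℝ)) ^ 2) = u k ^ 2 * ∑ i, ((v k i : ℝ)) ^ 2 := by
    rw [Finset.mul_sum]
    exact Finset.sum_congr rfl fun i _ => by ring
  rw [hsum, Real.sqrt_mul (sq_nonneg _), Real.sqrt_sq hk.le]

/-! ### The two-point law along a mesh sequence -/

/-- **The two-point law along a mesh sequence.** If `⟨σ₀σ_y⟩_{β_c}‖y‖₂^{2Δ} → c` as `y → ∞` in
`ℤ³` and `u k · v k → r ≠ 0` coordinatewise along a mesh sequence `u k → 0⁺`, then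
`⟨σ₀σ_{v k}⟩_{β_c} · (u k)^{-2Δ} → c ‖r‖₂^{-2Δ}`. [folklore] -/
theorem tendsto_criticalTwoPoint_mul_rpow {Δ c : ℝ}
    (hG : Tendsto (fun y : Site 3 => criticalTwoPoint 3 y * Real.sqrt (∑ i, ((y i : ℝ)) ^ 2) ^ (2 * Δ))
      cofinite (𝓝 c))
    {u : ℕ → ℝ} (hu : Tendsto u atTop (𝓝[>] (0 : ℝ))) {v : ℕ → Site 3}
    {r : EuclideanSpace ℝ (Fin 3)} (hr : r ≠ 0)
    (h : ∀ i, Tendsto (fun k => u k * (v k i : ℝ)) atTop (𝓝 (r i))) :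
    Tendsto (fun k => criticalTwoPoint 3 (v k) * (u k) ^ (-(2 * Δ))) atTop
      (𝓝 (c * ‖r‖ ^ (-(2 * Δ)))) := by
  have hupos : ∀ᶠ k in atTop, 0 < u k := (tendsto_nhdsWithin_iff.1 hu).2
  -- some coordinate of `r` is nonzero
  have hex : ¬ ∀ i, r i = 0 := fun h0 => hr (PiLp.ext fun i => by simpa using h0 i)
  obtain ⟨i, hi⟩ := not_forall.1 hex
  have hcof : Tendsto v atTop cofinite := tendsto_cofinite_of_mul_apply hu hi (h i)
  have hA : Tendsto (fun k => criticalTwoPoint 3 (v k) * Real.sqrt (∑ j, ((v k j : ℝ)) ^ 2) ^ (2 * Δ))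
      atTop (𝓝 c) := hG.comp hcof
  have hN : Tendsto (fun k => u k * Real.sqrt (∑ j, ((v k j : ℝ)) ^ 2)) atTop (𝓝 ‖r‖) :=
    tendsto_mul_sqrt_sum_sq hupos h
  have hNr : Tendsto (fun k => (u k * Real.sqrt (∑ j, ((v k j : ℝ)) ^ 2)) ^ (-(2 * Δ))) atTop
      (𝓝 (‖r‖ ^ (-(2 * Δ)))) := hN.rpow_const (Or.inl (norm_ne_zero_iff.2 hr))
  have hne : ∀ᶠ k in atTop, v k ≠ 0 := hcof.eventually (eventually_cofinite_ne 0)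
  refine (hA.mul hNr).congr' ?_
  filter_upwards [hupos, hne] with k hk hvk
  obtain ⟨j, hj⟩ : ∃ j, v k j ≠ 0 := Function.ne_iff.1 hvk
  have hEpos : 0 < Real.sqrt (∑ j, ((v k j : ℝ)) ^ 2) := by
    refine Real.sqrt_pos.2 (lt_of_lt_of_le ?_
      (Finset.single_le_sum (f := fun j => ((v k j : ℝ)) ^ 2) (fun j _ => sq_nonneg _)
        (Finset.mem_univ j)))
    have hj' : (v k j : ℝ) ≠ 0 := Int.cast_ne_zero.2 hj
    exact lt_of_le_of_ne (sq_nonneg _) (Ne.symm (pow_ne_zero 2 hj'))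
  have hE' : Real.sqrt (∑ j, ((v k j : ℝ)) ^ 2) ^ (2 * Δ) ≠ 0 := (Real.rpow_pos_of_pos hEpos _).ne'
  rw [Real.mul_rpow hk.le hEpos.le, Real.rpow_neg hEpos.le (2 * Δ)]
  field_simp

/-! ### The pinned renormalisation squared -/

/-- `ρ_pin(δ)² = ⟨σ₀σ_{⌊1/δ⌋e₀}⟩_{β_c}⁻¹` (`⟨σσ⟩ ≥ 0`). [folklore] -/
theorem rhoPin_sq (δ : ℝ) :
    rhoPin δ ^ 2 = (criticalTwoPoint 3 (Pi.single 0 (⌊1 / δ⌋ : ℤ)))⁻¹ := by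
  unfold rhoPin
  rw [← Real.rpow_natCast, ← Real.rpow_mul (criticalTwoPoint_nonneg' _)]
  norm_num
  exact Real.rpow_neg_one _

/-- The pinning site is a difference of lattice approximations:
`⌊1/δ⌋e₀ = [e₀/δ] − [0/δ]`. [folklore] -/
theorem piSingle_floor_eq_latticeApprox_sub (δ : ℝ) :
    (Pi.single 0 (⌊1 / δ⌋ : ℤ) : Site 3) =
      latticeApprox δ (EuclideanSpace.single 0 (1 : ℝ)) - latticeApprox δ 0 := by
  funext i
  rw [Pi.sub_apply, latticeApprox_apply, latticeApprox_apply, PiLp.zero_apply, zero_div,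
    Int.floor_zero, sub_zero]
  by_cases hi : i = 0
  · subst hi
    simp
  · simp [hi]

/-- The rescaled pinned two-point correlator is the ratio
`⟨σ₀σ_{[x₁/δ]−[x₀/δ]}⟩ / ⟨σ₀σ_{⌊1/δ⌋e₀}⟩`. [folklore] -/
theorem rescaledCorrelator_rhoPin_two (δ : ℝ) (x : Fin 2 → EuclideanSpace ℝ (Fin 3)) :
    rescaledCorrelator (criticalCorr 3) rhoPin 2 δ x =
      criticalTwoPoint 3 (latticeApprox δ (x 1) - latticeApprox δ (x 0)) /
        criticalTwoPoint 3 (Pi.single 0 (⌊1 / δ⌋ : ℤ)) := by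
  rw [rescaledCorrelator_apply, latticeApprox_comp_two, criticalCorr_two_pair, rhoPin_sq,
    inv_mul_eq_div]

/-! ### The stub -/

/-- **STUB 2 of the line `only-interaction-breaks-moebius` — the pinned two-point function under
the two-point law.** If `⟨σ₀σ_y⟩_{β_c} ‖y‖₂^{2Δ} → c > 0` (`y → ∞` in `ℤ³`; item stmt-0634, its
data passed as hypotheses), then EVERY cluster point of the pinned zoom has two-point function
`S 2 (x₀,x₁) = ‖x₀ − x₁‖^{-2Δ}` on non-coincident pairs: the rescaled correlator is the ratio
`⟨σ₀σ_{z_δ}⟩/⟨σ₀σ_{⌊1/δ⌋e₀}⟩`, `z_δ = [x₁/δ] − [x₀/δ]`, both sites escape to infinity along the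
mesh sequence, `δ‖z_δ‖₂ → ‖x₁ − x₀‖`, `δ⌊1/δ⌋ → 1`, and the two-point law gives the limit
`(c‖x₁−x₀‖^{-2Δ})/c`; the cluster-point value is this limit by uniqueness of limits.
[cite: DuminilCopinICM2022, §8.1 eq. (8.1)–(8.2)] -/
theorem stub_pinnedTwoPoint :
    ∀ (Δ c : ℝ), 0 < c →
      Tendsto (fun y : Site 3 => criticalTwoPoint 3 y * Real.sqrt (∑ i, ((y i : ℝ)) ^ 2) ^ (2 * Δ))
        cofinite (𝓝 c) →
      ∀ S : CorrFamily 3, IsClusterPoint S →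
        ∀ x ∈ NonCoincident 3 2, S 2 x = ‖x 0 - x 1‖ ^ (-(2 * Δ)) := by
  intro Δ c hc hG S hS x hx
  obtain ⟨u, hu, hconv⟩ := hS
  have hupos : ∀ᶠ k in atTop, 0 < u k := (tendsto_nhdsWithin_iff.1 hu).2
  have h01 : x 0 ≠ x 1 := ((mem_nonCoincident x).1 hx).ne (by decide)
  -- numerator: the two-point function at `z_k = [x₁/u k] − [x₀/u k]`
  have hz : Tendsto (fun k => criticalTwoPoint 3 (latticeApprox (u k) (x 1) - latticeApprox (u k) (x 0)) *
      (u k) ^ (-(2 * Δ))) atTop (𝓝 (c * ‖x 1 - x 0‖ ^ (-(2 * Δ)))) :=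
    tendsto_criticalTwoPoint_mul_rpow hG hu (sub_ne_zero.2 h01.symm)
      (fun i => tendsto_mul_latticeApprox_sub_apply hu (x 0) (x 1) i)
  -- denominator: the two-point function at the pinning site `⌊1/u k⌋ e₀`
  have he₀ : (EuclideanSpace.single 0 (1 : ℝ) : EuclideanSpace ℝ (Fin 3)) - 0 ≠ 0 := by
    rw [sub_zero, Ne, PiLp.single_eq_zero_iff]
    exact one_ne_zero
  have hw : Tendsto (fun k => criticalTwoPoint 3 (Pi.single 0 (⌊1 / u k⌋ : ℤ) : Site 3) *
      (u k) ^ (-(2 * Δ))) atTop (𝓝 c) := by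
    have h := tendsto_criticalTwoPoint_mul_rpow (Δ := Δ) hG hu he₀
      (fun i => tendsto_mul_latticeApprox_sub_apply hu 0 (EuclideanSpace.single 0 (1 : ℝ)) i)
    have h1 : ‖(EuclideanSpace.single 0 (1 : ℝ) : EuclideanSpace ℝ (Fin 3)) - 0‖ = 1 := by
      rw [sub_zero, PiLp.norm_single, norm_one]
    rw [h1, Real.one_rpow, mul_one] at h
    refine h.congr' (Eventually.of_forall fun k => ?_)
    simp only [piSingle_floor_eq_latticeApprox_sub]
  -- the quotient
  have hq := hz.div hw hc.ne'
  rw [mul_div_assoc, mul_div_left_comm, div_self hc.ne', mul_one] at hq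
  have hlim : Tendsto (fun k => rescaledCorrelator (criticalCorr 3) rhoPin 2 (u k) x) atTop
      (𝓝 (‖x 1 - x 0‖ ^ (-(2 * Δ)))) := by
    refine hq.congr' ?_
    filter_upwards [hupos] with k hk
    rw [Pi.div_apply, mul_div_mul_right _ _ (Real.rpow_pos_of_pos hk _).ne',
      rescaledCorrelator_rhoPin_two]
  rw [tendsto_nhds_unique ((hconv 2).tendsto_at hx) hlim, norm_sub_rev]

end Summit.CriticalPhenomena.Ising3DConformalLimit.MoebiusLimitExistsOnlyInteraction

end
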